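import Literature.MathematicalPhysics.QuantumFieldTheory.Balaban1983to89.B8Prop6CubeMemberGaugedGamma

/-!
# `Balaban1983to89.B8Prop6CubeMemberOfThm33Gamma` — [Balaban1985RegularSpaces] PROPOSITION 6 (p. 99) ON NODE 00's CUBE MEMBER `Node00.zdCub` FROM
# [Balaban1985BackgroundPropagators] THEOREM 3.3 BY NAME, EDITION γ, EXISTENCE ROAD — the N06→N05 junction knit of the cube road over print's split class
# `cubeLamBP'` («D3γ»): sockets = Prop. 5 ∃ base ∕ ∃ step + dag-n06-b's all-levels γ family; no `SockP5u`, no `zdGF3` letter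

statement-level skeleton of published theorems with citation tags; proofs where landed; nothing here is a claim about the
Yang–Mills mass gap

PDF held: `paper:balaban1985-cmp99-regular-spaces-gauge-fixing`; p. 99 (Proposition 6; «the assumptions of Theorem 4 are satisfied for the pair of configurations 1, U₀″,
thus there exists a gauge transformation u …»), Theorem 4 p. 88, Proposition 3 p. 87, Proposition 5 (1.107)–(1.108) p. 94, (1.31) p. 82, (1.59) p. 86, p. 77;
[4] `[Balaban1985BackgroundPropagators]` Thm 3.3 p. 399, (3.16) p. 393; [B6] `[Balaban1984PropagatorsII]` (2.3) p. 224.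

CITATION HEADER (lean-in-tree rule).  Cell `pub-ymgap` (HUMAN RULING D-0062, Track A), DAG node N05 = [B8]; width seat `pub-ymgap-k0-s2-w1` (g0; K0⁷ stub 2 =
[6] Prop. 6 at NODE 00's cube member; plan W-SEAT-START-LIST §k0-s2 items 1–2 «… from N06's [B9] Thm 3.3 socks at the ℤᵈ carrier»; dag-n05-e g9 HANDOFF §γ (t2)
«D2γ lands → D3γ = g9 D3 p569056 re-run on D2γ + n06-b supplier … then k0-s2-w1's door»).  WHY THIS FILE.  dag-n05-e's β junction knit
`B8Prop6CubeMemberOfThm33BetaExists.prop6Printed_zdCub_of_thm33β₃` (p569056) is VACUOUS at cube members (its derived socket family reads dag-n05-c's `cubeLamB`;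
interior shell gauge modes, certificate p572834).  EDITION γ: THIS FILE re-runs its §2∕§3 on this seat's γ assembler `B8Prop6CubeMemberGaugedGamma` («D2γ»:
Theorem 4's existence half AT THE DATUM, class `cubeLamBP'`) and dag-n06-b's γ supplier `B9SupplySockB9P3ZdGamma.sockB9P3D4γ_allLevels_of_thm33_on` (p579891;
datum class a PARAMETER `ΛbP`, here `cubeLamBP'`, with `seesDom_cubeLamBP'`).  The supplier is indexed by the cube sub-family of (1.131) CARRYING ITS CUBE DATUM
`(a, M, ρ)` (so that `ΛbP` is a function of the index): `J′ = {(i, (a, M, ρ)) : ZdIdx d L × (ℤᵈ × ℕ × ℕ) ∣ L ≤ ρ ≤ M, 11d < M, L ≤ dM, i.Ω = {□_j}, i.Λs = Λ′,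
i.Λb = cubeLamB}`.  Kind «kernel-checked proof», theorems only, no `def`.

WHAT IS PROVED (kernel, 0 sorry).
§1 ★★ `prop6Printed_zdCub_of_sockD4γFamily₃` — the BINDER-AGNOSTIC consumer: an all-levels four-line socket family `SockB9P3D4β L B₀ B_∂ c_{P9} η m {□_j} Λ′ (cubeLamBP' …)`
   at EVERY cube datum `(η, k, a, M, ρ)` of NODE 00's carrier + Prop. 5's two EXISTENCE sockets at the ENLARGED constant `B₀ˢ = max{max{1, B₀}, 4B_∂∕(dL − 1)}`
   ⟹ `∃ c₁ > 0, ∀ f, B8.Prop6Printed d L (5dL·B₀ˢ) c₁ (zdCub ∘ f)` (dag-n05-e p569056 §2 on D2γ; `2 ≤ 5dLB₀ˢ` and `4B_∂ ≤ (dL − 1)B₀ˢ` hold identically).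
§2 ★★★ `prop6Printed_zdCub_of_thm33γ₃` — THE JUNCTION KNIT, EDITION γ: `B9.Thm33Printed` BY NAME + dag-n06-b's member-local binders in edition γ on `J′`
   (`DictAt`, `Prop6At`, `InvAt`, `CurvAt`, `LandauAt`, ★ `AvgAtγ … (cubeLamBP' …)`) ⟹ `∃ B₀ˢ ≥ 1, ∀ {B₀′ c_P} > 0, SockP5base@(B₀ˢ) → SockP5@(B₀ˢ) → ∃ c₁ > 0, ∀ f,
   B8.Prop6Printed d L (5dL·B₀ˢ) c₁ (zdCub ∘ f)` — the plug shape of k0-s2-w1's K0 door `K0Stub2OfPrintedZdCub.prop6MemberB8At_of_prop6PrintedFamily` (p584116).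

HONEST SCOPE ∕ A6 (director-ym №189 (3)).  Compositions by name; nothing of [4] or of Propositions 3∕5 is proved.  Every socket∕binder is a HYPOTHESIS: the member-local
binder set {`DictAt`, `Prop6At`, `InvAt`, `CurvAt`, `LandauAt`, `AvgAtγ`, `Margin2`, Thm 3.3's block} behind §2 is INHABITED at every cube datum at truncation `m = 0`
by dag-n06-b's γ witness (`B9SupplySockB9P3ZdGamma.…nonvacuous_cubeLamBP'_zero` ∕ `binders_inhabited_cube_zero_γ`); NOT witnessed: the binders at `m ≥ 1`
([4] Sect. A + Thm 3.11, N06's object layer), `B9.Thm33Printed` itself (N06's node), Proposition 5's two existence sockets at cube members (N05's Prop.-5 lane; no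
cube-member provider in tree).  Unlike β, the interior shell modes do NOT inhabit the γ socket's datum (non-zero crossing data over print's class, dag-n05-c
`B8Ineq159FlatShellModeCrossingDatum`), so no vacuity certificate applies; no joint-satisfiability claim of the full ∀-m list is made.  β-shape partial vacuity below
an absolute `B₀` threshold is absorbed by `B₀ˢ ≥ 1`.  LOCATED-CARRIER (dag-n05-e; k0-s2-w2 p584299): binders∕sockets are asked at EVERY `CubeB8` cube datum (collars
`ρ = L` included) — beyond print's p. 98 cubes where `ρ < R₁M₁`.  Count-neutral; N05 ∕ K0⁷ stub 2 NOT discharged; one finite `𝕋⁴` programme at fixed `ε`, Bałaban AS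
PRINTED; nothing continuum ∕ ℝ⁴ ∕ OS ∕ mass-gap ∕ Clay (the Yang–Mills mass gap is NOT proved by any of this; route R4 closes the conditional finite-𝕋⁴ rung
`BalabanLadder.UV` only).  No `sorry`, no `def`, no `instance`, no `notation`.  Unit `pub-ymgap-k0-s2-w1` (g0), 2026-08-27.

RELATED IN THE TREE, NOT DUPLICATED (USED by name): `B8Prop6CubeMemberGaugedGamma.gaugedBoundB8_cubeMember_of_sockD4γ` (D2γ), `B9SupplySockB9P3ZdGamma.{cubeLamBP',
seesDom_cubeLamBP', sockB9P3D4γ_allLevels_of_thm33_on, AvgAtγ}` (dag-n06-b ∕ dag-n05-e), `B8LeafKnitZd3CubBdryBeta.sockB9P3D4β_mono_B₀`, `B9SupplySockB9P3ZdLettersOmega.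
margin2_cubeFam`, `B8Prop6CubeMemberOfThm33BetaExists` (β twin; history), `Node00.prop6Printed_zdCub_iff`.
-/

noncomputable section

open NormedSpace

namespace Literature.MathematicalPhysics.QuantumFieldTheory.Balaban1983to89.B8Prop6CubeMemberOfThm33Gamma

open MatrixLog B7Prop1Explicit B7Prop2Explicit B7Prop1Local B7Eq92Concrete
open B7Prop4GeneralLevels (logCovIter linCovIter)
open B8Ineq132 (InAk covDerivFwd BondTouches)
open B8Eq119TwistedAxial (Restr129 InAx)
open B8Eq140Level (SideTouches)
open B8Eq146AExpansion (iEta plaqCovDeriv)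
open B8Eq143PlaqExpansion (pdiv)
open B8Eq155JBound (Jcur wsup)
open B8ScaledSupNorm (bondNorm msup)
open B8Eq184Proof (gaugeExp cfgExp)
open B8Eq138LandauZd (IsLandau138W logCfg covLap)
open B8Lemma1NonAbelian (mulCfg)
open B8LeafModelZd (ZdIdx SockP5base SockP5)
open B8LeafModelZdOfHFP (sockP5base_anti sockP5_anti)
open B8Eq131CubesAdmissible (cubeFam)
open B8CubeMemberZd (cubeLamS cubeLamB hΩ_cubeFam hbox_cubeLamB hclass_cubeLamB htower_cubeLam hpart_cubeLam)
open B9SupplySockB9P3ZdLetters (OpsZd)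
open B9SupplySockB9P3ZdLettersOmega (Margin2 margin2_cubeFam)
open B9SupplySockB9P3ZdAt (DictAt Prop6At InvAt CurvAt LandauAt)
open B9SupplySockB9P3ZdBeta (CrossB SockB9P3D4β)
open B9SupplySockB9P3ZdGamma (cubeLamBP' seesDom_cubeLamBP' AvgAtγ sockB9P3D4γ_allLevels_of_thm33_on)
open B8LeafKnitZd3CubBdryBeta (sockB9P3D4β_mono_B₀)
open B8Prop6CubeMemberGaugedGamma (gaugedBoundB8_cubeMember_of_sockD4γ)
open Node00 (CubeB8 zdCub prop6Printed_zdCub_iff)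

-- `Site` alone could resolve to the torus sites of `Setup.lean`; re-export the `ℤ^d` sites of `B7Prop1Explicit`.
export B7Prop1Explicit (Site)

variable {d : ℕ}

variable {𝔸 : Type} [CStarAlgebra 𝔸] [Nontrivial 𝔸]

/-! ## §1 The binder-agnostic consumer in edition γ -/

/-- ★★ **PROPOSITION 6 ON THE CUBE MEMBERS FROM AN ALL-LEVELS FOUR-LINE SOCKET FAMILY OVER PRINT's SPLIT CLASS AT EVERY CUBE DATUM AND PROPOSITION 5's TWO EXISTENCE
SOCKETS — BINDER-AGNOSTIC, WINDOW-FREE, `SockP5u`-FREE, `zdGF3`-FREE** (dag-n05-e p569056 §2 re-run on D2γ): whatever supplies, for SOME `B₀`, `B_∂ ≥ 0`, `c_{P9} > 0`,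
the γ-class collar socket `SockB9P3D4β L B₀ B_∂ c_{P9} η m (cubeFam false L a M ρ k) (cubeLamS …) (cubeLamBP' …)` at EVERY cube datum `(η > 0, k ≥ 1, a, M, ρ)` of NODE 00's
carrier (`L ≤ ρ ≤ M`, `11d < M`, `L ≤ dM`) and EVERY truncation `m ≤ k` gives, with `SockP5base`∕`SockP5` at the ENLARGED constant `B₀ˢ = max{max{1, B₀}, 4B_∂∕(dL − 1)}`,
a threshold `c₁ > 0` with `B8.Prop6Printed d L (5dL·B₀ˢ) c₁` on `zdCub ∘ f` for every `f`.
[cite: Balaban1985RegularSpaces, Prop. 6 p.99, Prop. 3 p.87, Thm 4 p.88, Prop. 5 (1.107)–(1.108) p.94, (1.58)–(1.62) pp.86–87, (1.31) p.82; Balaban1984PropagatorsII, (2.3) p.224] -/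
theorem prop6Printed_zdCub_of_sockD4γFamily₃ (hd2 : 2 ≤ d) {L : ℕ} (hL : 2 ≤ L) {B₀ Bbd cP₉ B₀' cP : ℝ} (hBbd : 0 ≤ Bbd) (hcP₉ : 0 < cP₉) (hB₀' : 0 < B₀')
    (hcP : 0 < cP)
    (hall : ∀ (η : ℝ), 0 < η → ∀ (k : ℕ), 1 ≤ k → ∀ (a : Site d) (M ρ : ℕ), L ≤ ρ → ρ ≤ M → 11 * d < M → L ≤ d * M → ∀ m, m ≤ k →
      SockB9P3D4β (𝔸 := 𝔸) L B₀ Bbd cP₉ η m (cubeFam false L a M ρ k) (cubeLamS L a M ρ k) (cubeLamBP' L a M ρ k))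
    (SP5base : ∀ (η : ℝ), 0 < η → ∀ (k : ℕ), 1 ≤ k → ∀ (a : Site d) (M ρ : ℕ), L ≤ ρ → ρ ≤ M → 11 * d < M → L ≤ d * M →
      SockP5base (𝔸 := 𝔸) L (max (max 1 B₀) (4 * Bbd / ((d : ℝ) * L - 1))) B₀' cP η k (cubeFam false L a M ρ k) (cubeLamS L a M ρ k))
    (SP5 : ∀ (η : ℝ), 0 < η → ∀ (k : ℕ), 1 ≤ k → ∀ (a : Site d) (M ρ : ℕ), L ≤ ρ → ρ ≤ M → 11 * d < M → L ≤ d * M →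
      SockP5 (𝔸 := 𝔸) L (max (max 1 B₀) (4 * Bbd / ((d : ℝ) * L - 1))) B₀' cP η k (cubeFam false L a M ρ k) (cubeLamS L a M ρ k)) :
    ∃ c₁ : ℝ, 0 < c₁ ∧ ∀ {ι' : Type} (f : ι' → ZdIdx d L),
      B8.Prop6Printed d (L : ℝ) (5 * (d : ℝ) * L * (max (max 1 B₀) (4 * Bbd / ((d : ℝ) * L - 1)))) c₁ (fun j => zdCub 𝔸 L (f j)) := by
  have hL1 : 1 ≤ L := le_trans (by norm_num) hL
  have hLr : (2 : ℝ) ≤ L := by exact_mod_cast hL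
  have hdr : (2 : ℝ) ≤ d := by exact_mod_cast hd2
  have hdL : (0 : ℝ) < (d : ℝ) * L - 1 := by nlinarith [hLr, hdr]
  -- the ENLARGED constant
  set B₀S : ℝ := max (max 1 B₀) (4 * Bbd / ((d : ℝ) * L - 1)) with hB₀S_def
  have hB₀S1 : 1 ≤ B₀S := (le_max_left 1 B₀).trans (le_max_left _ _)
  have hB₀S : 0 < B₀S := lt_of_lt_of_le one_pos hB₀S1
  have hDS : B₀ ≤ B₀S := (le_max_right 1 B₀).trans (le_max_left _ _)
  have hB : 2 ≤ 5 * (d : ℝ) * L * B₀S := by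
    have h1 : (2 : ℝ) ≤ 5 * (d : ℝ) * L := by nlinarith [hLr, hdr]
    nlinarith [h1, hB₀S1]
  -- the absorption window holds IDENTICALLY at the enlarged constant
  have hBd : 4 * Bbd ≤ ((d : ℝ) * L - 1) * B₀S := by
    have h1 : 4 * Bbd / ((d : ℝ) * L - 1) ≤ B₀S := le_max_right _ _
    have h2 : 4 * Bbd = ((d : ℝ) * L - 1) * (4 * Bbd / ((d : ℝ) * L - 1)) := by field_simp
    rw [h2]
    exact mul_le_mul_of_nonneg_left h1 hdL.le
  obtain ⟨c₁, hc₁, G⟩ := gaugedBoundB8_cubeMember_of_sockD4γ (𝔸 := 𝔸) hd2 hL hB₀S hB hB₀' hcP hcP₉ hBbd hBd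
  refine ⟨c₁, hc₁, fun f => ?_⟩
  rw [prop6Printed_zdCub_iff]
  intro j α₀ hα U₀ hInA c hs
  have hρL : L ≤ c.ρ := c.L_le_ρ
  exact G (f j).η (f j).hη c (SP5base (f j).η (f j).hη c.k c.one_le_k c.a c.M c.ρ hρL c.ρ_le_M c.big c.L_le_dM)
    (SP5 (f j).η (f j).hη c.k c.one_le_k c.a c.M c.ρ hρL c.ρ_le_M c.big c.L_le_dM)
    (fun m hm => sockB9P3D4β_mono_B₀ hDS (f j).hη.le (hall (f j).η (f j).hη c.k c.one_le_k c.a c.M c.ρ hρL c.ρ_le_M c.big c.L_le_dM m hm))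
    U₀.1 U₀.2 α₀ hα hInA hs

#print axioms prop6Printed_zdCub_of_sockD4γFamily₃

/-! ## §2 The junction knit from Theorem 3.3 by name, edition γ, in the plug shape -/

/-- ★★★ **PROPOSITION 6 ON THE CUBE MEMBERS FROM [4] THEOREM 3.3 BY NAME, EDITION γ, EXISTENCE ROAD — the N06→N05 junction knit of the cube road over print's split
class.**  `B9.Thm33Printed` + dag-n06-b's six member-local [4]-letter binders in edition γ (`DictAt`, `Prop6At`, `InvAt`, `CurvAt`, `LandauAt`, ★ `AvgAtγ` at the class
`cubeLamBP'`) on the cube sub-family of (1.131) CARRYING ITS DATUM (index `J′`: a member `i` together with `(a, M, ρ)` presenting its domains) give, by dag-n06-b's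
`sockB9P3D4γ_allLevels_of_thm33_on` (`ΛbP := cubeLamBP'`, `SeesDom` by `seesDom_cubeLamBP'`, `Margin2` by `margin2_cubeFam`), an all-levels γ-class socket family at
every cube datum with constants `(B₀ᴰ, B_∂, c_{P9})` from Theorem 3.3's block alone; §1 turns it, with Proposition 5's TWO EXISTENCE sockets at `B₀ˢ ≥ 1` (quantified
AFTER `B₀ˢ` with their parameters `B₀′, c_P` — dag-n05-d's plug shape), into `B8.Prop6Printed d L (5dL·B₀ˢ) c₁` on `zdCub ∘ f` for every `f` — the input of k0-s2-w1's
K0 door `prop6MemberB8At_of_prop6PrintedFamily`.  A6 line in the module docstring.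
[cite: Balaban1985RegularSpaces, Prop. 6 p.99, Prop. 3 p.87, Thm 4 p.88, Prop. 5 (1.107)–(1.108) p.94, (1.56)–(1.62) pp.86–87, (1.31) p.82, p.77; Balaban1985BackgroundPropagators, Thm 3.3 p.399, (3.16) p.393; Balaban1984PropagatorsII, (2.3) p.224] -/
theorem prop6Printed_zdCub_of_thm33γ₃ (hd2 : 2 ≤ d) {L : ℕ} (hL : 2 ≤ L)
    {I : Type} (geo : I → B9.Geometry) (bg : I → B9.Backgrounds) (GA : ∀ i, B9.KernelFamily (geo i) (bg i))
    (mem : ℝ → ZdIdx d L → ℕ → I)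
    (ιCfg : ∀ (M : ℝ) (i : ZdIdx d L) (m : ℕ) (U₀ : Site d → Fin d → 𝔸ˣ), (∀ x κ, U₀ x κ ∈ unitaryUnits 𝔸) → (bg (mem M i m)).Cfg)
    (ιLoc : ∀ (M : ℝ) (i : ZdIdx d L) (m : ℕ), (Site d → Fin d → 𝔸) → (geo (mem M i m)).Loc)
    (ops : ℝ → ZdIdx d L → ℕ → OpsZd d 𝔸) {c35 c₆ K₆ M₃ a₃ c69 q : ℝ}
    {Gp : ∀ i, B9.KernelFamily (geo i) (bg i)} (h33 : B9.Thm33Printed c35 geo bg Gp GA)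
    (hdict : ∀ (M : ℝ) (j : {q : ZdIdx d L × (Site d × ℕ × ℕ) // L ≤ q.2.2.2 ∧ q.2.2.2 ≤ q.2.2.1 ∧ 11 * d < q.2.2.1 ∧ L ≤ d * q.2.2.1 ∧
          q.1.Ω = cubeFam false L q.2.1 q.2.2.1 q.2.2.2 q.1.k ∧ q.1.Λs = cubeLamS L q.2.1 q.2.2.1 q.2.2.2 q.1.k ∧ q.1.Λb = cubeLamB L q.2.1 q.2.2.1 q.2.2.2 q.1.k}) (m : ℕ),
      DictAt geo bg GA L mem ιCfg ιLoc ops M j.1.1 m)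
    (hP6 : ∀ (M : ℝ) (j : {q : ZdIdx d L × (Site d × ℕ × ℕ) // L ≤ q.2.2.2 ∧ q.2.2.2 ≤ q.2.2.1 ∧ 11 * d < q.2.2.1 ∧ L ≤ d * q.2.2.1 ∧
          q.1.Ω = cubeFam false L q.2.1 q.2.2.1 q.2.2.2 q.1.k ∧ q.1.Λs = cubeLamS L q.2.1 q.2.2.1 q.2.2.2 q.1.k ∧ q.1.Λb = cubeLamB L q.2.1 q.2.2.1 q.2.2.2 q.1.k}) (m : ℕ),
      M₃ ≤ M → Prop6At bg L mem ιCfg c35 c₆ K₆ M j.1.1 m)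
    (hinv : ∀ (M : ℝ) (j : {q : ZdIdx d L × (Site d × ℕ × ℕ) // L ≤ q.2.2.2 ∧ q.2.2.2 ≤ q.2.2.1 ∧ 11 * d < q.2.2.1 ∧ L ≤ d * q.2.2.1 ∧
          q.1.Ω = cubeFam false L q.2.1 q.2.2.1 q.2.2.2 q.1.k ∧ q.1.Λs = cubeLamS L q.2.1 q.2.2.1 q.2.2.2 q.1.k ∧ q.1.Λb = cubeLamB L q.2.1 q.2.2.1 q.2.2.2 q.1.k}) (m : ℕ),
      M₃ ≤ M → InvAt bg L mem ιCfg ops c35 a₃ M j.1.1 m)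
    (hcurv : ∀ (M : ℝ) (j : {q : ZdIdx d L × (Site d × ℕ × ℕ) // L ≤ q.2.2.2 ∧ q.2.2.2 ≤ q.2.2.1 ∧ 11 * d < q.2.2.1 ∧ L ≤ d * q.2.2.1 ∧
          q.1.Ω = cubeFam false L q.2.1 q.2.2.1 q.2.2.2 q.1.k ∧ q.1.Λs = cubeLamS L q.2.1 q.2.2.1 q.2.2.2 q.1.k ∧ q.1.Λb = cubeLamB L q.2.1 q.2.2.1 q.2.2.2 q.1.k}) (m : ℕ),
      M₃ ≤ M → CurvAt bg L mem ιCfg ops c35 a₃ c69 M j.1.1 m)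
    (hlan : ∀ (M : ℝ) (j : {q : ZdIdx d L × (Site d × ℕ × ℕ) // L ≤ q.2.2.2 ∧ q.2.2.2 ≤ q.2.2.1 ∧ 11 * d < q.2.2.1 ∧ L ≤ d * q.2.2.1 ∧
          q.1.Ω = cubeFam false L q.2.1 q.2.2.1 q.2.2.2 q.1.k ∧ q.1.Λs = cubeLamS L q.2.1 q.2.2.1 q.2.2.2 q.1.k ∧ q.1.Λb = cubeLamB L q.2.1 q.2.2.1 q.2.2.2 q.1.k}) (m : ℕ),
      M₃ ≤ M → LandauAt bg L mem ιCfg ops c35 a₃ M j.1.1 m)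
    (havg : ∀ (M : ℝ) (j : {q : ZdIdx d L × (Site d × ℕ × ℕ) // L ≤ q.2.2.2 ∧ q.2.2.2 ≤ q.2.2.1 ∧ 11 * d < q.2.2.1 ∧ L ≤ d * q.2.2.1 ∧
          q.1.Ω = cubeFam false L q.2.1 q.2.2.1 q.2.2.2 q.1.k ∧ q.1.Λs = cubeLamS L q.2.1 q.2.2.1 q.2.2.2 q.1.k ∧ q.1.Λb = cubeLamB L q.2.1 q.2.2.1 q.2.2.2 q.1.k}) (m : ℕ),
      AvgAtγ L ops q (cubeLamBP' L j.1.2.1 j.1.2.2.1 j.1.2.2.2 j.1.1.k) M j.1.1 m)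
    (hc₆ : 0 < c₆) (hK₆ : 0 < K₆) (ha₃ : 0 < a₃) (hc69 : 0 ≤ c69) (hq : 0 ≤ q) :
    ∃ B₀S : ℝ, 1 ≤ B₀S ∧ ∀ {B₀' cP : ℝ}, 0 < B₀' → 0 < cP →
      (∀ (η : ℝ), 0 < η → ∀ (k : ℕ), 1 ≤ k → ∀ (a : Site d) (M ρ : ℕ), L ≤ ρ → ρ ≤ M → 11 * d < M → L ≤ d * M →
        SockP5base (𝔸 := 𝔸) L B₀S B₀' cP η k (cubeFam false L a M ρ k) (cubeLamS L a M ρ k)) →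
      (∀ (η : ℝ), 0 < η → ∀ (k : ℕ), 1 ≤ k → ∀ (a : Site d) (M ρ : ℕ), L ≤ ρ → ρ ≤ M → 11 * d < M → L ≤ d * M →
        SockP5 (𝔸 := 𝔸) L B₀S B₀' cP η k (cubeFam false L a M ρ k) (cubeLamS L a M ρ k)) →
      ∃ c₁ : ℝ, 0 < c₁ ∧ ∀ {ι' : Type} (f : ι' → ZdIdx d L),
        B8.Prop6Printed d (L : ℝ) (5 * (d : ℝ) * L * B₀S) c₁ (fun j => zdCub 𝔸 L (f j)) := by
  have hL1 : 1 ≤ L := le_trans (by norm_num) hL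
  -- the cube members have `Margin2` (ρ ≥ L ≥ 2) and `SeesDom` for the split class
  have hMJ : ∀ j : {q : ZdIdx d L × (Site d × ℕ × ℕ) // L ≤ q.2.2.2 ∧ q.2.2.2 ≤ q.2.2.1 ∧ 11 * d < q.2.2.1 ∧ L ≤ d * q.2.2.1 ∧
      q.1.Ω = cubeFam false L q.2.1 q.2.2.1 q.2.2.2 q.1.k ∧ q.1.Λs = cubeLamS L q.2.1 q.2.2.1 q.2.2.2 q.1.k ∧ q.1.Λb = cubeLamB L q.2.1 q.2.2.1 q.2.2.2 q.1.k},
      Margin2 j.1.1.Ω := by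
    rintro ⟨⟨i, a, M, ρ⟩, hρ, -, -, -, hΩ, -, -⟩
    dsimp only at hΩ ⊢
    rw [hΩ]
    exact margin2_cubeFam L a M (hL.trans hρ) i.k
  have hsee : ∀ (j : {q : ZdIdx d L × (Site d × ℕ × ℕ) // L ≤ q.2.2.2 ∧ q.2.2.2 ≤ q.2.2.1 ∧ 11 * d < q.2.2.1 ∧ L ≤ d * q.2.2.1 ∧
      q.1.Ω = cubeFam false L q.2.1 q.2.2.1 q.2.2.2 q.1.k ∧ q.1.Λs = cubeLamS L q.2.1 q.2.2.1 q.2.2.2 q.1.k ∧ q.1.Λb = cubeLamB L q.2.1 q.2.2.1 q.2.2.2 q.1.k}) (m : ℕ),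
      m ≤ j.1.1.k → B9SupplySockB9P3ZdGamma.SeesDom L m (j.1.1.Ω 0) (cubeLamBP' L j.1.2.1 j.1.2.2.1 j.1.2.2.2 j.1.1.k) := by
    intro j
    obtain ⟨⟨i, a, M, ρ⟩, hρ, -, -, -, hΩ, -, -⟩ := j
    intro m hmk
    dsimp only at hΩ hmk ⊢
    rw [hΩ]
    exact seesDom_cubeLamBP' hL1 a M hρ hmk
  -- ONE call of dag-n06-b's γ junction over the datum-carrying cube sub-family: `B₀, cP9` depend on Theorem 3.3's block only
  obtain ⟨B₀, cP9, hB₀, hcP9, hall⟩ := sockB9P3D4γ_allLevels_of_thm33_on geo bg GA L mem ιCfg ιLoc ops hd2 hL1 h33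
    (fun j : {q : ZdIdx d L × (Site d × ℕ × ℕ) // L ≤ q.2.2.2 ∧ q.2.2.2 ≤ q.2.2.1 ∧ 11 * d < q.2.2.1 ∧ L ≤ d * q.2.2.1 ∧
      q.1.Ω = cubeFam false L q.2.1 q.2.2.1 q.2.2.2 q.1.k ∧ q.1.Λs = cubeLamS L q.2.1 q.2.2.1 q.2.2.2 q.1.k ∧ q.1.Λb = cubeLamB L q.2.1 q.2.2.1 q.2.2.2 q.1.k} => j.1.1)
    hMJ hdict hP6 hinv hcurv hlan (fun j => cubeLamBP' L j.1.2.1 j.1.2.2.1 j.1.2.2.2 j.1.1.k) havg hsee hc₆ hK₆ ha₃ hc69 hq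
  have hBbd : 0 ≤ (20 * (d : ℝ) + 2) * max 1 (2 * B₀ * max 1 q) := by positivity
  refine ⟨max (max 1 (max 1 (2 * B₀ * max 1 q))) (4 * ((20 * (d : ℝ) + 2) * max 1 (2 * B₀ * max 1 q)) / ((d : ℝ) * L - 1)),
    (le_max_left _ _).trans (le_max_left _ _), fun hB₀' hcP SP5base SP5 => ?_⟩
  -- the socket family, read at the cube DATA (the member of the sub-family presenting the datum)
  refine prop6Printed_zdCub_of_sockD4γFamily₃ (𝔸 := 𝔸) hd2 hL hBbd hcP9 hB₀' hcP (fun η hη k hk a M ρ hρL hρM hM hLdM m hm => ?_) SP5base SP5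
  exact hall ⟨(⟨η, hη, k, hk, cubeFam false L a M ρ k, hΩ_cubeFam hL1 a M hρL k, cubeLamS L a M ρ k, cubeLamB L a M ρ k, hbox_cubeLamB L a M ρ k,
      hclass_cubeLamB L a M ρ k, htower_cubeLam hL1 a M ρ k, hpart_cubeLam hL1 a M ρ k⟩, (a, M, ρ)), hρL, hρM, hM, hLdM, rfl, rfl, rfl⟩ m hm

#print axioms prop6Printed_zdCub_of_thm33γ₃

end Literature.MathematicalPhysics.QuantumFieldTheory.Balaban1983to89.B8Prop6CubeMemberOfThm33Gamma

end
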